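import Summits.QuantumAdvantage.AdviceFreeQNC0.OddPrimeStatements
import HarnessLib

/-!
# Cell qa-qnc0 (odd primes `p ≥ 5`, rung R4 from R3): `SparseOfGap p` — a sparse strategy has a long cut-free interval

Planner qa-qnc0-p2 g13, ROUND-13 §2 (rungs R3/R4) / `line13/Sketch13p2.lean` §4 (statements `anchorRes`, `activeCuts`,
`CutFree`, `WalkHardFGap p`, `WalkHardFSparse p`, `SparseOfGap p` VERBATIM).  PROVED here (dependency-free
pigeonhole, every `p`):

* `exists_cutFree_interval` — for every strategy `y` on `n` bits with `s` potentially-active cuts there is a CUT-FREE bit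
  interval `[i, i+L) ⊆ [0, n)` with `(s + 1)·L ≥ n`: the fibres of the monotone map `b ↦ #{active g ≤ b}` are
  `s + 1` cut-free intervals (a cut strictly inside a fibre would raise the count inside it).
* **`sparseOfGap : SparseOfGap p`** — `WalkHardFGap p → WalkHardFSparse p`: with `s³·(log₂ n)^{2C+3} ≤ n` the longest
  cut-free interval has `L ≥ n/(s+1) ≥ s²·(log₂ n)^{2C+2}` (`log₂ n ≥ 2`), so the gap rung applies.

So the sparse rung R4 (`WalkHardFSparse p`: `s ≤ n^{1/3}/polylog` potentially-active cuts, ANY geometry, polylog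
`𝔽_p`-degree) reduces to the gap rung R3 (`WalkHardFGap p`, one free-interval fibre + `ElimHardF p`, qn-prover g10).
WHAT THIS IS NOT: R3 itself is not proved here; nothing on the dense crux `WalkHardF p`; separation NOT moved.
-/

noncomputable section

namespace Summit.QuantumAdvantage.AdviceFreeQNC0

open Classical
open Finset

variable {n : ℕ}

/-! ### Statements (planner qa-qnc0-p2 Sketch13p2 §4, verbatim) -/

/-- The hidden trit of a cut `g` (charge-free): `(g + |u| + W_g(u)) mod 3`. (Sketch13p2 §4, verbatim.) -/
def anchorRes (u : Fin n → Bool) (g : ℕ) : ℕ := (g + walkExp u g) % 3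

/-- Potentially-active cuts of a strategy. (Sketch13p2 §4, verbatim.) -/
def activeCuts (y : Fin (n + 1) → (Fin n → Bool) → Bool) : Finset (Fin (n + 1)) :=
  univ.filter fun g => ∃ u : Fin n → Bool, y g u = true

/-- The bit interval `[i, i + L)` is CUT-FREE for `y`: every potentially-active cut lies weakly before `i` or weakly
after `i + L` (its prefix count involves none or all of the interval's bits). (Sketch13p2 §4, verbatim.) -/
def CutFree (i L : ℕ) (y : Fin (n + 1) → (Fin n → Bool) → Bool) : Prop :=
  ∀ g ∈ activeCuts y, g.val ≤ i ∨ i + L ≤ g.val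

/-- **`WalkHardFGap p`** (M, fact-free form): a polylog-degree `𝔽_p` strategy with `s` potentially-active cuts and a
cut-free bit interval of length `L ≥ s²·(log₂ n)^{2C+2}` wins at most `θ·2ⁿ` (`θ = 1 − η₀(p)/2 < 1`, all `C`).
(p = 2 needed only `L ≥ 2(log₂ n)^{2C+1}`, `ringWinU_lowDegGap_le`: over `𝔽₂` the XOR layer is free; over `𝔽_p` it
costs degree `s` — the quantitative signature of M2.) (Sketch13p2 §4, verbatim; rung R3, OPEN in the tree.) -/
def WalkHardFGap (p : ℕ) [Fact p.Prime] : Prop :=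
  ∃ θ : ℝ, θ < 1 ∧ ∀ C : ℕ, ∃ n₀ : ℕ, ∀ n ≥ n₀, ∀ c i L : ℕ, ∀ y : Fin (n + 1) → (Fin n → Bool) → Bool,
    (∀ g, HasDegF p (y g) ((Nat.log 2 n) ^ C)) → CutFree i L y → i + L ≤ n →
    (activeCuts y).card ^ 2 * (Nat.log 2 n) ^ (2 * C + 2) ≤ L →
      ((univ.filter fun u : Fin n → Bool => ringWinU c y u = true).card : ℝ) ≤ θ * (2 : ℝ) ^ n

/-- **`WalkHardFSparse p`** (the SPARSE RUNG, fact-free): strategies with `s` potentially-active cuts,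
`s³·(log₂ n)^{2C+3} ≤ n`, ANY geometry, win at most `θ·2ⁿ` — from `WalkHardFGap` on the longest of the `s + 1` gaps
(length `≥ n/(s+1)`).  Contains `WalkHardFAnchored` and every `k`-window configuration with `k·w` small; supersedes the
`B`-fold character route to p1's `WalkHardFSparse p B` (ROUND-14 §5), with no zero-letter risk.
(Sketch13p2 §4, verbatim; rung R4.) -/
def WalkHardFSparse (p : ℕ) [Fact p.Prime] : Prop :=
  ∃ θ : ℝ, θ < 1 ∧ ∀ C : ℕ, ∃ n₀ : ℕ, ∀ n ≥ n₀, ∀ c : ℕ, ∀ y : Fin (n + 1) → (Fin n → Bool) → Bool,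
    (∀ g, HasDegF p (y g) ((Nat.log 2 n) ^ C)) →
    (activeCuts y).card ^ 3 * (Nat.log 2 n) ^ (2 * C + 3) ≤ n →
      ((univ.filter fun u : Fin n → Bool => ringWinU c y u = true).card : ℝ) ≤ θ * (2 : ℝ) ^ n

/-- `WalkHardFGap p → WalkHardFSparse p` (S: pigeonhole on the `s + 1` gaps). PROVED: `sparseOfGap`.
(Sketch13p2 §4, verbatim.) -/
def SparseOfGap (p : ℕ) [Fact p.Prime] : Prop := WalkHardFGap p → WalkHardFSparse p

/-! ### The longest cut-free interval -/

namespace CutFreeInterval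

/-- The fibre index of a bit `b`: the number of cuts of `A` weakly to the left of `b` (cut `g` sits between bits
`g − 1` and `g`). Monotone in `b`. -/
def key (A : Finset (Fin (n + 1))) (b : Fin n) : ℕ := (A.filter fun g => g.val ≤ b.val).card

/-- `key` is monotone along the bit positions. -/
theorem key_mono (A : Finset (Fin (n + 1))) {b b' : Fin n} (h : b.val ≤ b'.val) : key A b ≤ key A b' :=
  Finset.card_le_card (fun g hg => by
    rw [mem_filter] at hg ⊢; exact ⟨hg.1, le_trans hg.2 h⟩)

/-- `key` takes values in `[0, |A|]`. -/
theorem key_le (A : Finset (Fin (n + 1))) (b : Fin n) : key A b ≤ A.card := Finset.card_filter_le _ _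

/-- A cut strictly between two bits raises the fibre index. -/
theorem key_lt_of_cut (A : Finset (Fin (n + 1))) {g : Fin (n + 1)} (hg : g ∈ A) {b b' : Fin n}
    (h1 : b.val < g.val) (h2 : g.val ≤ b'.val) : key A b < key A b' := by
  unfold key
  refine Finset.card_lt_card ⟨fun g' hg' => ?_, fun hsub => ?_⟩
  · rw [mem_filter] at hg' ⊢; exact ⟨hg'.1, by omega⟩
  · have hmem : g ∈ A.filter fun g' => g'.val ≤ b'.val := by rw [mem_filter]; exact ⟨hg, h2⟩
    have := hsub hmem
    rw [mem_filter] at this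
    omega

/-- **Pigeonhole**: some fibre of `key` has at least `n/(|A|+1)` bits. -/
theorem exists_big_fibre (A : Finset (Fin (n + 1))) :
    ∃ k : ℕ, n ≤ (A.card + 1) * (univ.filter fun b : Fin n => key A b = k).card := by
  by_contra hcon
  push Not at hcon
  have hmaps : ∀ b ∈ (univ : Finset (Fin n)), key A b ∈ Finset.range (A.card + 1) :=
    fun b _ => Finset.mem_range.2 (Nat.lt_succ_of_le (key_le A b))
  have hsum := Finset.card_eq_sum_card_fiberwise hmaps
  rw [card_univ, Fintype.card_fin] at hsum
  -- `(|A|+1)·n = Σ_k (|A|+1)·|fibre k| < (|A|+1)·n` unless `n = 0`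
  by_cases hn : n = 0
  · have h0 := hcon 0
    omega
  · have hlt : (A.card + 1) * n < (A.card + 1) * n := by
      calc (A.card + 1) * n
          = ∑ k ∈ Finset.range (A.card + 1), (A.card + 1) * (univ.filter fun b : Fin n => key A b = k).card := by
            rw [← Finset.mul_sum, ← hsum]
        _ ≤ ∑ _k ∈ Finset.range (A.card + 1), (n - 1) :=
            Finset.sum_le_sum fun k _ => by have := hcon k; omega
        _ = (A.card + 1) * (n - 1) := by rw [Finset.sum_const, Finset.card_range, smul_eq_mul]
        _ < (A.card + 1) * n := Nat.mul_lt_mul_of_pos_left (by omega) (Nat.succ_pos _)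
    exact lt_irrefl _ hlt

/-- **The longest cut-free interval**: for every finite set `A` of cuts on `n` bits there is a bit interval
`[i, i + L) ⊆ [0, n)` containing no cut of `A` strictly inside, with `(|A| + 1)·L ≥ n`. -/
theorem exists_free_interval (A : Finset (Fin (n + 1))) :
    ∃ i L : ℕ, (∀ g ∈ A, g.val ≤ i ∨ i + L ≤ g.val) ∧ i + L ≤ n ∧ n ≤ (A.card + 1) * L := by
  by_cases hn : n = 0
  · exact ⟨0, 0, fun g _ => Or.inr (Nat.zero_le _), by omega, by omega⟩
  obtain ⟨k, hk⟩ := exists_big_fibre A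
  obtain ⟨B, hB⟩ : ∃ B : Finset (Fin n), B = univ.filter fun b : Fin n => key A b = k := ⟨_, rfl⟩
  have hBmem : ∀ b : Fin n, b ∈ B ↔ key A b = k := fun b => by rw [hB]; simp
  rw [← hB] at hk
  have hBne : B.Nonempty := by
    rw [← Finset.card_pos]
    by_contra h0
    have : B.card = 0 := by omega
    rw [this, mul_zero] at hk
    omega
  obtain ⟨i, hi⟩ : ∃ i : ℕ, i = (B.min' hBne).val := ⟨_, rfl⟩
  have hkmin : key A (B.min' hBne) = k := (hBmem _).1 (Finset.min'_mem B hBne)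
  have himin : ∀ b ∈ B, i ≤ b.val := fun b hb => by
    rw [hi]; exact Fin.le_def.1 (Finset.min'_le B b hb)
  refine ⟨i, B.card, fun g hg => ?_, ?_, hk⟩
  · -- cut-freeness
    by_contra hcon
    push Not at hcon
    obtain ⟨h1, h2⟩ := hcon
    -- some bit of `B` lies weakly right of the cut `g`
    have hex : ∃ b₂ ∈ B, g.val ≤ b₂.val := by
      by_contra hno
      push Not at hno
      have hcard : B.card ≤ (Finset.Ico i g.val).card := by
        refine Finset.card_le_card_of_injOn (fun b => b.val) (fun b hb => ?_) (fun b _ b' _ h => Fin.ext h)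
        rw [Finset.mem_coe] at hb
        rw [Finset.mem_coe, Finset.mem_Ico]
        exact ⟨himin b hb, hno b hb⟩
      rw [Nat.card_Ico] at hcard
      omega
    obtain ⟨b₂, hb₂, hgb₂⟩ := hex
    have hb₂n : b₂.val < n := b₂.isLt
    -- the bits `g − 1` and `g` both lie in `[i, b₂]`, hence in the fibre `k`; but the cut `g` separates them
    have hk₁ : k ≤ key A ⟨g.val - 1, by omega⟩ := by
      rw [← hkmin]
      exact key_mono A (by show (B.min' hBne).val ≤ g.val - 1; omega)
    have hk₂ : key A ⟨g.val, by omega⟩ ≤ k := by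
      rw [← (hBmem b₂).1 hb₂]
      exact key_mono A (by show g.val ≤ b₂.val; exact hgb₂)
    have hlt := key_lt_of_cut A hg (b := ⟨g.val - 1, by omega⟩) (b' := ⟨g.val, by omega⟩)
      (by show g.val - 1 < g.val; omega) (by show g.val ≤ g.val; exact le_rfl)
    omega
  · -- `[i, i + |B|) ⊆ [0, n)`
    have hcard : B.card ≤ (Finset.Ico i n).card := by
      refine Finset.card_le_card_of_injOn (fun b => b.val) (fun b hb => ?_) (fun b _ b' _ h => Fin.ext h)
      rw [Finset.mem_coe] at hb
      rw [Finset.mem_coe, Finset.mem_Ico]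
      exact ⟨himin b hb, b.isLt⟩
    rw [Nat.card_Ico] at hcard
    omega

end CutFreeInterval

/-- **A cut-free interval of length `≥ n/(s+1)` always exists** (`s` = number of potentially-active cuts). -/
theorem exists_cutFree_interval (y : Fin (n + 1) → (Fin n → Bool) → Bool) :
    ∃ i L : ℕ, CutFree i L y ∧ i + L ≤ n ∧ n ≤ ((activeCuts y).card + 1) * L :=
  CutFreeInterval.exists_free_interval (activeCuts y)

/-! ### R4 from R3 -/

/-- Degree budget: `s³·(log₂ n)^{2C+3} ≤ n ≤ (s+1)·L` and `log₂ n ≥ 2` give `s²·(log₂ n)^{2C+2} ≤ L`. -/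
private theorem budget {s ℓ C L n : ℕ} (hℓ : 2 ≤ ℓ) (hs : s ^ 3 * ℓ ^ (2 * C + 3) ≤ n)
    (hL : n ≤ (s + 1) * L) : s ^ 2 * ℓ ^ (2 * C + 2) ≤ L := by
  rcases Nat.eq_zero_or_pos s with rfl | hspos
  · simp
  · have hX : 1 ≤ ℓ ^ (2 * C + 2) := Nat.one_le_pow _ _ (by omega)
    have h1 : s ^ 3 * ℓ ^ (2 * C + 3) ≤ 2 * s * L := by
      calc s ^ 3 * ℓ ^ (2 * C + 3) ≤ n := hs
        _ ≤ (s + 1) * L := hL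
        _ ≤ 2 * s * L := Nat.mul_le_mul_right _ (by omega)
    have h2 : s * (s ^ 2 * ℓ ^ (2 * C + 2) * ℓ) ≤ s * (2 * L) := by
      calc s * (s ^ 2 * ℓ ^ (2 * C + 2) * ℓ) = s ^ 3 * ℓ ^ (2 * C + 3) := by ring
        _ ≤ 2 * s * L := h1
        _ = s * (2 * L) := by ring
    have h3 : s ^ 2 * ℓ ^ (2 * C + 2) * ℓ ≤ 2 * L := Nat.le_of_mul_le_mul_left h2 hspos
    nlinarith

/-- **R4 from R3: `SparseOfGap p` — PROVED for every `p`.** -/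
theorem sparseOfGap (p : ℕ) [Fact p.Prime] : SparseOfGap p := by
  rintro ⟨θ, hθ, hG⟩
  refine ⟨θ, hθ, fun C => ?_⟩
  obtain ⟨n₀, hn₀⟩ := hG C
  refine ⟨max n₀ 4, fun n hn c y hdeg hs => ?_⟩
  have hlog : 2 ≤ Nat.log 2 n := Nat.le_log_of_pow_le (by norm_num) (le_trans (le_max_right _ _) hn)
  obtain ⟨i, L, hcf, hiL, hbig⟩ := exists_cutFree_interval y
  exact hn₀ n (le_trans (le_max_left _ _) hn) c i L y hdeg hcf hiL (budget hlog hs hbig)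

end Summit.QuantumAdvantage.AdviceFreeQNC0

end
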